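import Mathlib
import HarnessLib

/-!
# ValiantsHypothesis / SymPencil — crux `EquivariantSdcNotQP` (stmt-ValiantsHypothesis-17792), line
# `birth_EquivariantSdcNotQP`, open piece (iii″) of `stub_permify`: the FROBENIUS RETRACT
# (an irreducible matrix representation with an `L`-invariant functional is an equivariant retract of
# the permutation representation on `G/L`)

After `…FiniteConjugationLift.lean` and `…PermEmbeddingBridge.lean`, the registered stub `stub_permify`
rests on (iii″): every representation `ρ : G →* GL_{m₀}(ℂ)` of a finite central extension `G` of
`𝔖_n × 𝔖_n` (scalar unimodular on the kernel) is an equivariant RETRACT of a permutation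
representation of quasi-polynomial degree.  The proof in print splits `ℂ^{m₀}` into irreducibles
(Maschke) and embeds each SMALL irreducible `W` into the permutation module on `G/L` for a Young-type
subgroup `L` fixing a vector of `W` (Young's rule `S^λ ⊆ M^λ`), each LARGE one into the regular
module.  This file (helper of the item, `--supports stmt-ValiantsHypothesis-17792 --as helper`;
0 definitions / 0 named facts) supplies the generic mechanism of the small case, in the matrix currency
of (iii″):
* `permRetract_frobenius` — **Frobenius retract**: if `ρ : G →* GL_k(ℂ)` (`G` finite) is IRREDUCIBLE
  (no invariant subspace besides `⊥, ⊤`) and `ℓ ≠ 0` is a linear functional invariant under a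
  subgroup `L`, then there are `ι : ℂ^k → ℂ^{[G:L]}`, `p` with `p ι = 1` and permutations `τ g` of
  `Fin [G:L]` with `P_{τ g} ι = ι ρ(g)`, `p P_{τ g} = ρ(g) p` (`ι w = (ℓ(ρ(s_c)⁻¹ w))_c` over coset
  representatives; its kernel is invariant and misses the coset of `1`; `p` is the `G`-average of a
  left inverse);
* `permRetract_conj` — the retract property is invariant under `ρ ↦ S ρ S⁻¹`;
* `toLin'_permMatrix` — bookkeeping.
What remains of (iii″) after this file, the width seat's regular retraction / direct sums, and the
bridge is pure representation theory of `𝔖_n × 𝔖_n`: the Maschke split in matrix currency and the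
dichotomy «an irreducible constituent of dimension `< 2^{c n}` has a nonzero functional invariant under
a subgroup of index `2^{O((log dim + log n)^2)}`» (Young's rule + Specht/spin degree bounds).

Honest framing: `stub_permify`, the crux `SymPencil.EquivariantSdcNotQP` and `VP ≠ VNP` remain OPEN;
nothing here is progress on them.
-/

noncomputable section

set_option linter.dupNamespace false

namespace Summit.ValiantsHypothesis.ValiantsHypothesis.Theorems.SymPencilEquivariantSdcNotQP

open Matrix

/-- Permutation matrices act on coordinate vectors by pre-composition. [folklore] -/
theorem toLin'_permMatrix {m : ℕ} (σ : Equiv.Perm (Fin m)) :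
    Matrix.toLin' (σ.permMatrix ℂ) = LinearMap.funLeft ℂ ℂ σ := by
  refine LinearMap.ext fun v => ?_
  rw [Matrix.toLin'_apply, Matrix.permMatrix_mulVec]
  rfl

/-- **Conjugation invariance of the retract property.**  If `ρ` is an equivariant retract of a
permutation action through `(ι, p, τ)` then so is `S ρ S⁻¹`, through `(ι S⁻¹, S p, τ)`. [folklore] -/
theorem permRetract_conj {G : Type*} {k m' : ℕ} (ρ : G → Matrix (Fin k) (Fin k) ℂ)
    (S : GL (Fin k) ℂ) (ι : Matrix (Fin m') (Fin k) ℂ) (p : Matrix (Fin k) (Fin m') ℂ)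
    (τ : G → Equiv.Perm (Fin m')) (hpι : p * ι = 1)
    (h : ∀ g, (τ g).permMatrix ℂ * ι = ι * ρ g ∧ p * (τ g).permMatrix ℂ = ρ g * p) :
    (S : Matrix (Fin k) (Fin k) ℂ) * p * (ι * ((S⁻¹ : GL (Fin k) ℂ) : Matrix (Fin k) (Fin k) ℂ)) = 1 ∧
    ∀ g, (τ g).permMatrix ℂ * (ι * ((S⁻¹ : GL (Fin k) ℂ) : Matrix (Fin k) (Fin k) ℂ)) =
        (ι * ((S⁻¹ : GL (Fin k) ℂ) : Matrix (Fin k) (Fin k) ℂ)) *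
          ((S : Matrix (Fin k) (Fin k) ℂ) * ρ g * ((S⁻¹ : GL (Fin k) ℂ) : Matrix (Fin k) (Fin k) ℂ)) ∧
      ((S : Matrix (Fin k) (Fin k) ℂ) * p) * (τ g).permMatrix ℂ =
        ((S : Matrix (Fin k) (Fin k) ℂ) * ρ g * ((S⁻¹ : GL (Fin k) ℂ) : Matrix (Fin k) (Fin k) ℂ)) *
          ((S : Matrix (Fin k) (Fin k) ℂ) * p) := by
  have hSS : ((S⁻¹ : GL (Fin k) ℂ) : Matrix (Fin k) (Fin k) ℂ) * (S : Matrix (Fin k) (Fin k) ℂ) = 1 :=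
    Units.inv_mul S
  have hSS' : (S : Matrix (Fin k) (Fin k) ℂ) * ((S⁻¹ : GL (Fin k) ℂ) : Matrix (Fin k) (Fin k) ℂ) = 1 :=
    Units.mul_inv S
  refine ⟨?_, fun g => ⟨?_, ?_⟩⟩
  · calc (S : Matrix (Fin k) (Fin k) ℂ) * p * (ι * ((S⁻¹ : GL (Fin k) ℂ) : Matrix (Fin k) (Fin k) ℂ))
        = (S : Matrix (Fin k) (Fin k) ℂ) * (p * ι) * ((S⁻¹ : GL (Fin k) ℂ) : Matrix (Fin k) (Fin k) ℂ) := by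
          simp only [Matrix.mul_assoc]
      _ = 1 := by rw [hpι, Matrix.mul_one, hSS']
  · rw [← Matrix.mul_assoc, (h g).1]
    simp only [Matrix.mul_assoc]
    rw [← Matrix.mul_assoc ((S⁻¹ : GL (Fin k) ℂ) : Matrix (Fin k) (Fin k) ℂ) (S : Matrix (Fin k) (Fin k) ℂ),
      hSS, Matrix.one_mul]
  · calc (S : Matrix (Fin k) (Fin k) ℂ) * p * (τ g).permMatrix ℂ
        = (S : Matrix (Fin k) (Fin k) ℂ) * (p * (τ g).permMatrix ℂ) := by rw [Matrix.mul_assoc]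
      _ = (S : Matrix (Fin k) (Fin k) ℂ) * (ρ g * p) := by rw [(h g).2]
      _ = (S : Matrix (Fin k) (Fin k) ℂ) * ρ g *
            (((S⁻¹ : GL (Fin k) ℂ) : Matrix (Fin k) (Fin k) ℂ) * (S : Matrix (Fin k) (Fin k) ℂ)) * p := by
          rw [hSS, Matrix.mul_one, Matrix.mul_assoc]
      _ = _ := by simp only [Matrix.mul_assoc]

/-- **Frobenius retract.**  Let `ρ : G →* GL_k(ℂ)` (`G` finite) be IRREDUCIBLE (no invariant subspace
other than `⊥, ⊤`) and let `ℓ ≠ 0` be a linear functional invariant under a subgroup `L`.  Then `ℂ^k`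
is an equivariant retract of the permutation representation of `G` on `G/L`: there are
`ι : ℂ^k → ℂ^{[G:L]}`, `p : ℂ^{[G:L]} → ℂ^k` with `p ι = 1` and permutations `τ g` of the `[G:L]`
coordinates with `P_{τ g} ι = ι ρ(g)`, `p P_{τ g} = ρ(g) p` (`ι w = (ℓ(ρ(s_c)⁻¹ w))_c` over coset
representatives `s_c`; `ker ι` is invariant and misses the coset of `1`; `p` = average of a left
inverse).  This is the mechanism of Young's rule `S^λ ⊆ M^λ` read in matrix currency. [folklore] -/
theorem permRetract_frobenius (G : Type) [Group G] [Finite G] (L : Subgroup G) (k : ℕ)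
    (ρ : G →* GL (Fin k) ℂ) (ℓ : (Fin k → ℂ) →ₗ[ℂ] ℂ)
    (hirr : ∀ W : Submodule ℂ (Fin k → ℂ),
      (∀ g : G, W ≤ W.comap (Matrix.toLin' (ρ g : Matrix (Fin k) (Fin k) ℂ))) → W = ⊥ ∨ W = ⊤)
    (hℓ0 : ℓ ≠ 0)
    (hℓ : ∀ l ∈ L, ℓ ∘ₗ Matrix.toLin' (ρ l : Matrix (Fin k) (Fin k) ℂ) = ℓ) :
    ∃ (m' : ℕ) (ι : Matrix (Fin m') (Fin k) ℂ) (p : Matrix (Fin k) (Fin m') ℂ)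
      (τ : G → Equiv.Perm (Fin m')),
      m' = L.index ∧ p * ι = 1 ∧
      ∀ g : G, (τ g).permMatrix ℂ * ι = ι * (ρ g : Matrix (Fin k) (Fin k) ℂ) ∧
        p * (τ g).permMatrix ℂ = (ρ g : Matrix (Fin k) (Fin k) ℂ) * p := by
  classical
  haveI : Fintype G := Fintype.ofFinite G
  -- the representation as linear maps
  set R : G → ((Fin k → ℂ) →ₗ[ℂ] (Fin k → ℂ)) :=
    fun g => Matrix.toLin' (ρ g : Matrix (Fin k) (Fin k) ℂ) with hR
  have hRmul : ∀ a b : G, R (a * b) = R a ∘ₗ R b := by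
    intro a b; simp only [hR, map_mul, Units.val_mul, Matrix.toLin'_mul]
  have hRone : R 1 = LinearMap.id := by simp only [hR, map_one, Units.val_one, Matrix.toLin'_one]
  have hRinv : ∀ a : G, R a⁻¹ ∘ₗ R a = LinearMap.id := by
    intro a; rw [← hRmul, inv_mul_cancel, hRone]
  -- cosets, their enumeration and representatives
  set m' : ℕ := Nat.card (G ⧸ L) with hm'
  let e : (G ⧸ L) ≃ Fin m' := Finite.equivFin (G ⧸ L)
  let s : Fin m' → G := fun c => (e.symm c).out
  have hs : ∀ c : Fin m', (QuotientGroup.mk (s c) : G ⧸ L) = e.symm c := fun c => Quotient.out_eq' _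
  -- the permutations: `τ g c = g⁻¹ • c`
  let τ : G → Equiv.Perm (Fin m') := fun g =>
    (e.symm.trans (MulAction.toPerm (g⁻¹ : G))).trans e
  have hτ : ∀ g c, e.symm (τ g c) = g⁻¹ • e.symm c := by
    intro g c; simp [τ]
  -- representatives move by elements of `L`: `s (τ g c) = g⁻¹ * s c * l`
  have hsl : ∀ g c, ∃ l ∈ L, s (τ g c) = g⁻¹ * s c * l := by
    intro g c
    have h1 : (QuotientGroup.mk (s (τ g c)) : G ⧸ L) = QuotientGroup.mk (g⁻¹ * s c) := by
      rw [hs, hτ, ← hs c, MulAction.Quotient.smul_coe, smul_eq_mul]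
    rw [QuotientGroup.eq] at h1
    refine ⟨((s (τ g c))⁻¹ * (g⁻¹ * s c))⁻¹, L.inv_mem h1, ?_⟩
    group
  -- the embedding `Λ w = (ℓ (R (s c)⁻¹ w))_c`
  set Λ : (Fin k → ℂ) →ₗ[ℂ] (Fin m' → ℂ) := LinearMap.pi fun c => ℓ ∘ₗ R (s c)⁻¹ with hΛ
  have hΛapply : ∀ w c, Λ w c = ℓ (R (s c)⁻¹ w) := fun w c => rfl
  -- equivariance: `Λ (R g w) = (Λ w) ∘ τ g`
  have hΛeq : ∀ g, LinearMap.funLeft ℂ ℂ (τ g) ∘ₗ Λ = Λ ∘ₗ R g := by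
    intro g
    refine LinearMap.ext fun w => funext fun c => ?_
    simp only [LinearMap.coe_comp, Function.comp_apply, LinearMap.funLeft_apply, hΛapply]
    obtain ⟨l, hl, hsl'⟩ := hsl g c
    rw [hsl', _root_.mul_inv_rev, _root_.mul_inv_rev, inv_inv, hRmul, hRmul]
    have := LinearMap.congr_fun (hℓ l⁻¹ (L.inv_mem hl))
    simp only [LinearMap.coe_comp, Function.comp_apply] at this ⊢
    rw [this]
  -- injectivity: the kernel is invariant and not everything
  have hker : LinearMap.ker Λ = ⊥ := by
    have hinv : ∀ g : G, LinearMap.ker Λ ≤ (LinearMap.ker Λ).comap (R g) := by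
      intro g w hw
      rw [Submodule.mem_comap, LinearMap.mem_ker]
      rw [LinearMap.mem_ker] at hw
      have := LinearMap.congr_fun (hΛeq g) w
      simp only [LinearMap.coe_comp, Function.comp_apply] at this
      rw [← this, hw, map_zero]
    rcases hirr _ hinv with h | h
    · exact h
    · exfalso
      apply hℓ0
      refine LinearMap.ext fun w => ?_
      have hw : w ∈ LinearMap.ker Λ := h ▸ Submodule.mem_top
      rw [LinearMap.mem_ker] at hw
      -- read the coordinate of the coset of `1`
      set c₁ : Fin m' := e (QuotientGroup.mk 1) with hc₁
      have h1 : s c₁ ∈ L := by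
        have : (QuotientGroup.mk (s c₁) : G ⧸ L) = QuotientGroup.mk 1 := by rw [hs, hc₁, e.symm_apply_apply]
        rw [QuotientGroup.eq] at this
        simpa using L.inv_mem this
      have := congr_fun hw c₁
      rw [hΛapply, Pi.zero_apply] at this
      have hfix := LinearMap.congr_fun (hℓ (s c₁)⁻¹ (L.inv_mem h1)) w
      simp only [LinearMap.coe_comp, Function.comp_apply] at hfix
      rw [hfix] at this
      simpa using this
  -- a left inverse, then average it
  obtain ⟨p₀, hp₀⟩ := Λ.exists_leftInverse_of_injective hker
  set Q : G → ((Fin m' → ℂ) →ₗ[ℂ] (Fin m' → ℂ)) := fun g => LinearMap.funLeft ℂ ℂ (τ g) with hQ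
  have hQmul : ∀ a b : G, Q (a * b) = Q a ∘ₗ Q b := by
    intro a b
    refine LinearMap.ext fun v => funext fun c => ?_
    simp only [hQ, LinearMap.funLeft_apply, LinearMap.coe_comp, Function.comp_apply]
    congr 1
    apply e.symm.injective
    simp only [hτ, _root_.mul_inv_rev, mul_smul]
  set P : (Fin m' → ℂ) →ₗ[ℂ] (Fin k → ℂ) :=
    ((Fintype.card G : ℂ)⁻¹) • ∑ g : G, R g ∘ₗ p₀ ∘ₗ Q g⁻¹ with hP
  have hcard : (Fintype.card G : ℂ) ≠ 0 := by exact_mod_cast Fintype.card_ne_zero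
  have hQΛ : ∀ g w, Q g (Λ w) = Λ (R g w) := fun g w => by
    have := LinearMap.congr_fun (hΛeq g) w
    simpa only [LinearMap.coe_comp, Function.comp_apply] using this
  have hp₀Λ : ∀ w, p₀ (Λ w) = w := fun w => LinearMap.congr_fun hp₀ w
  have hRR : ∀ g w, R g (R g⁻¹ w) = w := fun g w => by
    have := LinearMap.congr_fun (hRinv g⁻¹) w
    simpa only [inv_inv, LinearMap.coe_comp, Function.comp_apply, LinearMap.id_apply] using this
  have hQQ : ∀ a b v, Q a (Q b v) = Q (a * b) v := fun a b v => by
    rw [hQmul]; rfl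
  have hPΛ : P ∘ₗ Λ = LinearMap.id := by
    refine LinearMap.ext fun w => ?_
    simp only [hP, LinearMap.coe_comp, Function.comp_apply, LinearMap.smul_apply, LinearMap.sum_apply,
      LinearMap.id_apply, hQΛ, hp₀Λ, hRR, Finset.sum_const, Finset.card_univ]
    rw [← Nat.cast_smul_eq_nsmul ℂ, smul_smul, inv_mul_cancel₀ hcard, one_smul]
  have hPQ : ∀ h : G, P ∘ₗ Q h = R h ∘ₗ P := by
    intro h
    refine LinearMap.ext fun v => ?_
    simp only [hP, LinearMap.coe_comp, Function.comp_apply, LinearMap.smul_apply, LinearMap.sum_apply,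
      map_smul, map_sum, hQQ]
    congr 1
    refine Fintype.sum_equiv (Equiv.mulLeft h⁻¹) _ _ fun g => ?_
    simp only [Equiv.coe_mulLeft, _root_.mul_inv_rev, inv_inv, hRmul, LinearMap.coe_comp,
      Function.comp_apply, hRR]
  -- pass to matrices
  refine ⟨m', LinearMap.toMatrix' Λ, LinearMap.toMatrix' P, τ, (Subgroup.index_eq_card L).symm ▸ rfl, ?_, fun g => ⟨?_, ?_⟩⟩
  · rw [← LinearMap.toMatrix'_comp, hPΛ, LinearMap.toMatrix'_id]
  · have hperm : (τ g).permMatrix ℂ = LinearMap.toMatrix' (Q g) := by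
      rw [hQ]; dsimp only; rw [← toLin'_permMatrix, LinearMap.toMatrix'_toLin']
    rw [hperm, ← LinearMap.toMatrix'_comp, hQ]
    dsimp only
    rw [hΛeq g, LinearMap.toMatrix'_comp, hR]
    dsimp only
    rw [LinearMap.toMatrix'_toLin']
  · have hperm : (τ g).permMatrix ℂ = LinearMap.toMatrix' (Q g) := by
      rw [hQ]; dsimp only; rw [← toLin'_permMatrix, LinearMap.toMatrix'_toLin']
    rw [hperm, ← LinearMap.toMatrix'_comp, hPQ g, LinearMap.toMatrix'_comp, hR]
    dsimp only
    rw [LinearMap.toMatrix'_toLin']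

end Summit.ValiantsHypothesis.ValiantsHypothesis.Theorems.SymPencilEquivariantSdcNotQP

end
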